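import Mathlib
import HarnessLib
import Summits.QuantumFields.YangMills.Theses.SqueezedSkewness

/-!
# LINE «SqueezedSkewness» (route-QuantumFields-SqueezedSkewness; ym-idea-6 g2, lens oqh) — the Assembly item, PROVED

Crux workfile for `stmt-QuantumFields-19353` (`BalabanLadder.NT`, rung R2a).  The route's deciding theorem is
`closes (hA : Assembly) (h1 : PointlikeMirrorFloors) (h2 : SqueezedFactorisation) : BalabanLadder.NT := hA h1 h2`;
this file discharges `Assembly` (item stmt-QuantumFields-25919) sorry-free, so the line's open obligations are exactly
the residual `PointlikeMirrorFloors` (25918, clause-(i) class) and the deciding `SqueezedFactorisation` (25917).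
A prover may land it verbatim as `Summits/QuantumFields/YangMills/Theorems/SqueezedSkewnessAssembly.lean`
(`--workitem stmt-QuantumFields-25919`).  Bookkeeping: X1 gives `(r, a, v, ε)` at the radius `ρ` named by X2, X2 gives
`(h, w, δ, σ)`; clause (i) is X1's floor, clause (ii) the triple `(v, θv, h)` with `ε₃ = (1−δ)·w·ε`, since
`|Q3| ≥ |σ·w·Q2| − δ·w·Q2 = (1−δ)·w·Q2 ≥ (1−δ)·w·ε`.  No summit is proved by this line.
-/

namespace Summit.QuantumFields.YangMills.Cruxes.NT.SqueezedSkewness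

open Literature.MathematicalPhysics.QuantumFieldTheory Literature.MathematicalPhysics.QuantumLattice
open Summit.QuantumFields.YangMills.Cruxes.OSLegsFromFemtoAndGap.DlrCollarTransfer
open Summit.QuantumFields.YangMills.Theses.SqueezedSkewness

/-- The route's `Assembly` item: `PointlikeMirrorFloors → SqueezedFactorisation → BalabanLadder.NT`. [folklore] -/
theorem assembly_proof : Summit.QuantumFields.YangMills.Theses.SqueezedSkewness.Assembly := by
  intro h1 h2

  intro G _ _ _ _ hG
  letI : MeasurableSpace G := borel G
  haveI : BorelSpace G := ⟨rfl⟩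
  obtain ⟨r, a, ha, ha0, hfl⟩ := h1 G hG
  obtain ⟨ρ, hρ, hsq⟩ := h2 G hG r a ha ha0
  obtain ⟨v, hv0, hball, hpos, ε, β₅, Λ₅, hε, hfloor⟩ := hfl ρ hρ
  obtain ⟨h, d1, d2, d3, w, δ, σ, hw, hδ, hσ, β₆, Λ₆, hfac⟩ := hsq v hv0 hball ⟨ε, β₅, Λ₅, hε, hfloor⟩
  refine ⟨r, a, ha, ha0, ⟨v, ε, β₅, Λ₅, hpos, hε, hfloor⟩, ?_⟩
  refine ⟨v, thetaTest 4 v, h, (1 - δ) * w * ε, max β₅ β₆, max Λ₅ Λ₆, d1, d2, d3, ?_, ?_⟩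
  · have h1δ : 0 < 1 - δ := by linarith
    positivity
  · intro β hβ L hL
    have hβ5 : β₅ ≤ β := le_trans (le_max_left _ _) hβ
    have hβ6 : β₆ ≤ β := le_trans (le_max_right _ _) hβ
    have hL5 : Λ₅ ≤ a β * L := le_trans (le_max_left _ _) hL
    have hL6 : Λ₆ ≤ a β * L := le_trans (le_max_right _ _) hL
    have hF := hfloor β hβ5 L hL5
    have hA := hfac β hβ6 L hL6
    have h1δ : 0 < 1 - δ := by linarith
    have hwq : ε * w ≤ w * Q2 G r β L (a β) (thetaTest 4 v) v := by nlinarith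
    have key : (1 - δ) * (w * Q2 G r β L (a β) (thetaTest 4 v) v) ≤
        |Q3 G r β L (a β) v (thetaTest 4 v) h| := by
      have hA' := abs_le.mp hA
      rcases hσ with rfl | rfl
      · rw [le_abs]; left; nlinarith [hA'.1]
      · rw [le_abs]; right; nlinarith [hA'.2]
    calc (1 - δ) * w * ε = (1 - δ) * (ε * w) := by ring
      _ ≤ (1 - δ) * (w * Q2 G r β L (a β) (thetaTest 4 v) v) :=
          mul_le_mul_of_nonneg_left hwq h1δ.le
      _ ≤ _ := key


/-- Hence the rung leaf from the two open items alone. [folklore] -/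
theorem nt_of_items (h1 : PointlikeMirrorFloors) (h2 : SqueezedFactorisation) :
    Summit.QuantumFields.YangMills.Theses.BalabanLadder.NT :=
  assembly_proof h1 h2

end Summit.QuantumFields.YangMills.Cruxes.NT.SqueezedSkewness
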